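/-
Copyright (c) 2026 the pub-hodgecm-mathlib formalisation cell (harness21).  Prover seat hodgecm-mathlib-K2Liu-p10 (g3), Track B «K2-LIT»,
#184♮ = hLiu418 = `stmt-HodgeConjecture-24832`; LEAD F0P6-plan (g13) RULING «M-157j» (1): G5-a sub-organ (α) (the middle cell of the
constant term), file α2b — THE SORTED BRUHAT PATTERN and, for `n = 2`, ONE FIXED MIDDLE REPRESENTATIVE `w₀`.
THEOREMS ONLY (no `def`, no `instance`, no named-fact hypothesis, no `sorry`).
-/
import Mathlib.Data.Fin.Tuple.Sort
import Mathlib.LinearAlgebra.Matrix.Permutation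
import Summits.HodgeConjecture.HodgeConjecture.Theorems.K2LiuSiegelBruhatMiddleCellExhaustion
import HarnessLib

/-!
# Crux `HLiu418`, ROAD Φ, (α) file α2b: THE SORTED `0∕1` PATTERN OF A MIDDLE COSET, AND FOR `n = 2` THE SINGLE REPRESENTATIVE `w₀ = ι(1, diag(1, −1) ⊗ 1)`

Cell `hodgecm-mathlib`, crux item hLiu418 = `stmt-HodgeConjecture-24832` (helper lane, count-neutral).  ★ B2c
`K2LiuSiegelBruhatMiddleCellExhaustion.exists_siegel_mul_refl_mul_siegel` writes every rational `γ` off the big cell as `p · w_χ · p'` with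
`p, p' ∈ P_Δ(L⁺)` and a `0∕1` pattern `χ` with a zero entry; the pattern is only determined up to a PERMUTATION of `Fin n` (its number of ones is
`rank C(γ)`).  Conjugating by a rational permutation Levi element sorts it, so the pattern may be taken MONOTONE (`i ≤ j → χ i = 1 → χ j = 1`):
* §1 (any field `K`): `exists_perm_sorted` (a pattern composed with `Tuple.sort` of its `ℕ`-shadow `𝟙[χ = 1]` is monotone),
  **`exists_sorted_normalForm`** (`d · C · a = −2·diag χ` with `χ` monotone — ★ (X1) `exists_mul_mul_eq_neg_two_smul_diagonal` followed by the permutation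
  matrices `P_σ · (−2 diag χ) · P_σ⁻¹ = −2 diag(χ ∘ σ)`), `pattern_fin_two_eq` (on `Fin 2` a monotone pattern with a `0` and a `1` is `![0, 1]`);
* §2 (the doubled unitary group `H(𝔸)`): **`exists_siegel_conj_sorted_normalForm`**, **`exists_siegel_mul_refl_mul_siegel_sorted`** — ★ B2c's two faces
  with the extra monotonicity clause (same proofs, (X1) replaced by §1);
* §3 (`n = 2`, i.e. `e : Fin N × Fin M ≃ Fin 2`): `rationalPair_eq_of_coe_eq`, `mul_self_of_coe_eq_signDiagonal`, `exists_reflStd`, and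
  **`exists_siegel_mul_reflStd_mul_siegel`** — EVERY rational `γ` off `P_Δ` and off the big cell is `p · w₀ · p'` with `p, p' ∈ P_Δ(L⁺)` and THE ONE
  representative `w₀ = ι(1, g₀ ⊗ 1)`, `g₀ = diag(1 − 2·![0,1] ∘ e)` (any rational pair with that matrix — they are all equal); so for `U(2,2)`-type doubling
  the middle of `P_Δ(L⁺)∖H(L⁺)` is the single double coset `P_Δ w₀ P_Δ` ([GPSR87, Part A §1]: cells ↔ `rank C ∈ {0, 1, 2}`).
Consumers: α2d `K2LiuConstantTermMiddleCellOrbits` (orbits of the middle cell ≃ `B(L)∖GL₂(L)`), α3 `K2LiuConstantTermMiddleCellGL2`.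
Sources: [GelbartPiatetskishapiroRallis1987, Part A §§1–2]; [KudlaRallis1994, §1]; [MoeglinWaldspurger1995, II.1.7].
HONEST LABEL.  Helper lemmas, count-neutral; `HC_CM` is proved only modulo the 7 printed citations (2 remaining named inputs:
hLiu418 = `stmt-HodgeConjecture-24832`, h413 = `stmt-HodgeConjecture-24833`) until rung 0 closes.
-/

set_option autoImplicit false
set_option linter.dupNamespace false -- the mandated namespace repeats `HodgeConjecture.HodgeConjecture`

noncomputable section

open scoped Matrix Kronecker
open NumberField IsDedekindDomain
open Literature.NumberTheory.Automorphic Literature.NumberTheory.Automorphic.UnitaryGroup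
open Literature.NumberTheory.GelbartRogawski1991 Literature.NumberTheory.GelbartRogawski1991.GRConstruction
open Literature.NumberTheory.K2Lit.SiegelDoubled
open UnitaryDualPair

namespace Summit.HodgeConjecture.HodgeConjecture.Cruxes.HLiu418.K2LiuSiegelMiddleCellSortedPattern

open K2LiuSiegelDoubledBlkUnitary K2LiuSiegelDoubledRationalPoints K2LiuSiegelDoubledLeviMatrix
open K2LiuSiegelBruhatCells K2LiuSiegelBruhatCellsUnitary K2LiuSiegelBruhatCellsDelta K2LiuSiegelBruhatMiddleCellDelta
open K2LiuSiegelBruhatRankNormalForm K2LiuSiegelDoubledRationalFrames K2LiuSiegelBruhatMiddleCellExhaustion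

/-! ## §1 Sorting a `0∕1` pattern; the sorted rank normal form over a field -/

section Perm

variable {K : Type*} [CommRing K] {n : ℕ}

/-- **a pattern can be sorted**: there is a permutation `σ` of `Fin n` with `χ ∘ σ` monotone for the order `χ = 1` last (zeros∕others first, ones
last) — `σ = Tuple.sort` of the `ℕ`-valued shadow `𝟙[χ = 1]`. [folklore] -/
theorem exists_perm_sorted (χ : Fin n → K) :
    ∃ σ : Equiv.Perm (Fin n), ∀ i j : Fin n, i ≤ j → χ (σ i) = 1 → χ (σ j) = 1 := by
  classical
  refine ⟨Tuple.sort (fun k => if χ k = 1 then (1 : ℕ) else 0), fun i j hij hi => ?_⟩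
  have hm := Tuple.monotone_sort (fun k => if χ k = 1 then (1 : ℕ) else 0) hij
  simp only [Function.comp_apply, hi, if_true] at hm
  by_contra hj
  rw [if_neg hj] at hm
  exact Nat.not_succ_le_zero 0 hm

/-- conjugating a diagonal matrix by a permutation matrix permutes the diagonal: `P_σ · diag d · P_{σ⁻¹} = diag (d ∘ σ)`. [folklore] -/
theorem perm_mul_diagonal_mul_perm (σ : Equiv.Perm (Fin n)) (d : Fin n → K) :
    σ.toPEquiv.toMatrix * Matrix.diagonal d * σ.symm.toPEquiv.toMatrix = Matrix.diagonal (d ∘ σ) := by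
  rw [PEquiv.toMatrix_toPEquiv_mul, PEquiv.mul_toMatrix_toPEquiv, Matrix.submatrix_submatrix, Equiv.symm_symm,
    Function.comp_id, Function.id_comp, Matrix.submatrix_diagonal_equiv]

/-- a permutation matrix has unit determinant. [folklore] -/
theorem isUnit_det_perm (σ : Equiv.Perm (Fin n)) : IsUnit (σ.toPEquiv.toMatrix : Matrix (Fin n) (Fin n) K).det := by
  refine Matrix.isUnit_det_of_right_inverse (B := σ.symm.toPEquiv.toMatrix) ?_
  rw [← PEquiv.toMatrix_trans, ← Equiv.toPEquiv_trans, Equiv.self_trans_symm, Equiv.toPEquiv_refl, PEquiv.toMatrix_refl]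

end Perm

section Field

variable {K : Type*} [Field K] [NeZero (2 : K)] {n : ℕ}

/-- **THE SORTED RANK NORMAL FORM**: every `C ∈ M_n(K)` is `d · C · a = −2 · diag χ` with `d, a` invertible and a MONOTONE `0∕1` pattern `χ`
(`i ≤ j → χ i = 1 → χ j = 1`, i.e. `χ = (0,…,0,1,…,1)` with `rank C` ones) — ★ (X1) followed by a permutation conjugation.
[cite: GelbartPiatetskishapiroRallis1987, Part A §1] [cite: MoeglinWaldspurger1995, II.1.7] -/
theorem exists_sorted_normalForm (C : Matrix (Fin n) (Fin n) K) :
    ∃ (d a : Matrix (Fin n) (Fin n) K) (χ : Fin n → K), IsUnit d.det ∧ IsUnit a.det ∧ (∀ k, χ k = 0 ∨ χ k = 1) ∧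
      (∀ i j : Fin n, i ≤ j → χ i = 1 → χ j = 1) ∧ d * C * a = -((2 : K) • Matrix.diagonal χ) := by
  obtain ⟨d, a, χ, hd, ha, hχ, h⟩ := exists_mul_mul_eq_neg_two_smul_diagonal C
  obtain ⟨σ, hσ⟩ := exists_perm_sorted χ
  refine ⟨σ.toPEquiv.toMatrix * d, a * σ.symm.toPEquiv.toMatrix, χ ∘ σ, ?_, ?_, fun k => hχ (σ k), fun i j hij => hσ i j hij, ?_⟩
  · rw [Matrix.det_mul]; exact (isUnit_det_perm σ).mul hd
  · rw [Matrix.det_mul]; exact ha.mul (isUnit_det_perm σ.symm)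
  · calc σ.toPEquiv.toMatrix * d * C * (a * σ.symm.toPEquiv.toMatrix)
        = σ.toPEquiv.toMatrix * (d * C * a) * σ.symm.toPEquiv.toMatrix := by simp only [Matrix.mul_assoc]
      _ = -((2 : K) • Matrix.diagonal (χ ∘ σ)) := by
        rw [h, Matrix.mul_neg, Matrix.neg_mul, Matrix.mul_smul, Matrix.smul_mul, perm_mul_diagonal_mul_perm]

omit [NeZero (2 : K)] in
/-- **on `Fin 2` the sorted middle pattern is `(0, 1)`**: a monotone `0∕1` pattern with a zero entry and a one entry is `![0, 1]`. [folklore] -/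
theorem pattern_fin_two_eq {χ : Fin 2 → K} (hχ : ∀ k, χ k = 0 ∨ χ k = 1) (hmono : ∀ i j : Fin 2, i ≤ j → χ i = 1 → χ j = 1)
    (h0 : ∃ k, χ k = 0) (h1 : ∃ k, χ k = 1) : χ = ![0, 1] := by
  obtain ⟨k₀, hk₀⟩ := h0
  obtain ⟨k₁, hk₁⟩ := h1
  have hχ0 : χ 0 = 0 := by
    rcases hχ 0 with h | h
    · exact h
    · exfalso
      have h1' : χ 1 = 1 := hmono 0 1 (Fin.zero_le _) h
      fin_cases k₀
      · exact one_ne_zero (h.symm.trans hk₀)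
      · exact one_ne_zero (h1'.symm.trans hk₀)
  have hχ1 : χ 1 = 1 := by
    rcases hχ 1 with h | h
    · exfalso
      fin_cases k₁
      · exact one_ne_zero (hk₁.symm.trans hχ0)
      · exact one_ne_zero (hk₁.symm.trans h)
    · exact h
  funext k
  fin_cases k
  · exact hχ0
  · exact hχ1

end Field

/-! ## §2 The sorted faces in the doubled unitary group -/

section Doubled

variable (L : Type) [Field L] [NumberField L] [IsCMField L]
variable {N M n : ℕ} (e : Fin N × Fin M ≃ Fin n)
  (dV : Fin N → L) (hdV : ∀ i, IsCMField.complexConj L (dV i) = dV i)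
  (dW : Fin M → L) (hdW : ∀ i, IsCMField.complexConj L (dW i) = dW i)

/-- **sorted normal form of the `C`-block by rational Siegel elements**: ★ B2c `exists_siegel_conj_normalForm` with a MONOTONE pattern —
for `γ ∈ H(L⁺)` there are a monotone `0∕1` pattern `χ` and `m₁, m₂ ∈ P_Δ(L⁺)` with `C(m₁ γ m₂) = −2·diag(χ ⊗ 1)`; if `det C(γ)` is not a unit then
`χ` has a zero entry.  (§1 `exists_sorted_normalForm` on the rational frame, transported by ★ `exists_rat_siegel_frame₂₂ ∕ ₁₁`.)
[cite: GelbartPiatetskishapiroRallis1987, Part A §1] [cite: MoeglinWaldspurger1995, II.1.7] -/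
theorem exists_siegel_conj_sorted_normalForm (hdV0 : ∀ i, dV i ≠ 0) (hdW0 : ∀ i, dW i ≠ 0) {γ : HA L e dV hdV dW hdW}
    (hγ : γ ∈ ratH L e dV hdV dW hdW) :
    ∃ (χ : Fin n → L) (m₁ m₂ : HA L e dV hdV dW hdW), (∀ k, χ k = 0 ∨ χ k = 1) ∧ (∀ i j : Fin n, i ≤ j → χ i = 1 → χ j = 1) ∧
      m₁ ∈ ratH L e dV hdV dW hdW ∧ IsSiegelDelta L e dV hdV dW hdW m₁ ∧ m₂ ∈ ratH L e dV hdV dW hdW ∧ IsSiegelDelta L e dV hdV dW hdW m₂ ∧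
      (Matrix.fromBlocks (1 : Matrix (Fin n) (Fin n) (AdeleRing (𝓞 L) L)) 0 (-1) 1 * blk L e dV hdV dW hdW (m₁ * γ * m₂) * Matrix.fromBlocks 1 0 1 1).toBlocks₂₁ =
        -((2 : AdeleRing (𝓞 L) L) • Matrix.diagonal (fun i => algebraMap L (AdeleRing (𝓞 L) L) (χ i))) ∧
      (¬ IsUnit (Matrix.fromBlocks (1 : Matrix (Fin n) (Fin n) (AdeleRing (𝓞 L) L)) 0 (-1) 1 * blk L e dV hdV dW hdW γ * Matrix.fromBlocks 1 0 1 1).toBlocks₂₁.det →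
        ∃ k, χ k = 0) := by
  obtain ⟨F₀, hF₀⟩ := exists_frame_eq_map_of_mem_ratH L e dV hdV dW hdW hγ
  obtain ⟨d₀, a₀, χ, hd₀, ha₀, hχ, hmono, hnf⟩ := exists_sorted_normalForm F₀.toBlocks₂₁
  have hd₀u : IsUnit d₀ := (Matrix.isUnit_iff_isUnit_det d₀).2 hd₀
  have ha₀u : IsUnit a₀ := (Matrix.isUnit_iff_isUnit_det a₀).2 ha₀
  obtain ⟨m₁, hm₁r, hm₁P, a₁, b₁, hm₁⟩ := exists_rat_siegel_frame₂₂ L e dV hdV dW hdW hdV0 hdW0 hd₀u.unit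
  obtain ⟨m₂, hm₂r, hm₂P, b₂, d₂, hm₂⟩ := exists_rat_siegel_frame₁₁ L e dV hdV dW hdW hdV0 hdW0 ha₀u.unit
  rw [hd₀u.unit_spec] at hm₁
  rw [ha₀u.unit_spec] at hm₂
  have hFb : F₀.map (algebraMap L (AdeleRing (𝓞 L) L)) = Matrix.fromBlocks (F₀.toBlocks₁₁.map (algebraMap L (AdeleRing (𝓞 L) L)))
      (F₀.toBlocks₁₂.map (algebraMap L (AdeleRing (𝓞 L) L))) (F₀.toBlocks₂₁.map (algebraMap L (AdeleRing (𝓞 L) L)))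
      (F₀.toBlocks₂₂.map (algebraMap L (AdeleRing (𝓞 L) L))) := by
    rw [← Matrix.fromBlocks_map, Matrix.fromBlocks_toBlocks]
  refine ⟨χ, m₁, m₂, hχ, hmono, hm₁r, hm₁P, hm₂r, hm₂P, ?_, fun hn => ?_⟩
  · rw [conj_blk_mul, conj_blk_mul, hm₁, hm₂, hF₀, hFb]
    simp only [Matrix.fromBlocks_multiply, Matrix.toBlocks_fromBlocks₂₁, Matrix.zero_mul, zero_add, Matrix.mul_zero, add_zero]
    rw [← Matrix.map_mul, ← Matrix.map_mul, hnf, Matrix.map_neg _ (map_neg _),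
      Matrix.map_smulₛₗ _ _ (2 : L) (fun a => by rw [smul_eq_mul, smul_eq_mul, map_mul]) _, map_ofNat, Matrix.diagonal_map (map_zero _)]
  · refine exists_apply_eq_zero_of_not_isUnit hχ hnf fun hu => hn ?_
    rw [hF₀, hFb, Matrix.toBlocks_fromBlocks₂₁]
    have h := hu.map (algebraMap L (AdeleRing (𝓞 L) L))
    rwa [RingHom.map_det] at h

/-- **THE SORTED FACE (X)**: ★ B2c `exists_siegel_mul_refl_mul_siegel` with a MONOTONE pattern — every `γ ∈ H(L⁺)` whose `C`-block is not invertible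
is `γ = p · w_χ · p'` with `p, p' ∈ P_Δ(L⁺)` (rational and Siegel), `w_χ = ι(1, γ_χ ⊗ 1)` for a rational sign involution `γ_χ = diag(1 − 2χ∘e)`,
`γ_χ² = 1`, and a monotone `0∕1` pattern `χ = (0,…,0,1,…,1)` with a zero entry.  So `P_Δ(L⁺)∖H(L⁺)/P_Δ(L⁺)` has at most `n + 1` cells, one per rank.
[cite: GelbartPiatetskishapiroRallis1987, Part A §§1–2] [cite: KudlaRallis1994, §1] [cite: MoeglinWaldspurger1995, II.1.7] -/
theorem exists_siegel_mul_refl_mul_siegel_sorted (hdV0 : ∀ i, dV i ≠ 0) (hdW0 : ∀ i, dW i ≠ 0) {γ : HA L e dV hdV dW hdW}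
    (hγ : γ ∈ ratH L e dV hdV dW hdW)
    (hn : ¬ IsUnit (Matrix.fromBlocks (1 : Matrix (Fin n) (Fin n) (AdeleRing (𝓞 L) L)) 0 (-1) 1 * blk L e dV hdV dW hdW γ * Matrix.fromBlocks 1 0 1 1).toBlocks₂₁.det) :
    ∃ (g : UnitaryGroup.rationalPair (Fp L) L (IsCMField.complexConj L) N M (Matrix.diagonal dV) (Matrix.diagonal dW)) (χ : Fin n → L)
      (p p' : HA L e dV hdV dW hdW), (∀ k, χ k = 0 ∨ χ k = 1) ∧ (∀ i j : Fin n, i ≤ j → χ i = 1 → χ j = 1) ∧ (∃ k, χ k = 0) ∧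
      ((g : GL (Fin N × Fin M) L) : Matrix (Fin N × Fin M) (Fin N × Fin M) L) = Matrix.diagonal (fun k => 1 - 2 * χ (e k)) ∧ g * g = 1 ∧
      p ∈ ratH L e dV hdV dW hdW ∧ IsSiegelDelta L e dV hdV dW hdW p ∧ p' ∈ ratH L e dV hdV dW hdW ∧ IsSiegelDelta L e dV hdV dW hdW p' ∧
      γ = p * iotaGG L e dV hdV dW hdW
        (1, UnitaryGroup.rationalPairToAdelic (Fp L) L (IsCMField.complexConj L) N M (Matrix.diagonal dV) (Matrix.diagonal dW) g) * p' := by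
  obtain ⟨χ, m₁, m₂, hχ, hmono, hm₁r, hm₁P, hm₂r, hm₂P, hC, hk⟩ := exists_siegel_conj_sorted_normalForm L e dV hdV dW hdW hdV0 hdW0 hγ
  obtain ⟨g, u, p₂, hg, hgg, huN, hur, hp₂r, hp₂P, hγ'⟩ :=
    exists_unip_refl_siegel_of_normalForm L e dV hdV dW hdW hdV0 hdW0 (mul_mem (mul_mem hm₁r hγ) hm₂r) hχ hC
  refine ⟨g, χ, m₁⁻¹ * u, p₂ * m₂⁻¹, hχ, hmono, hk hn, hg, hgg, mul_mem (inv_mem hm₁r) hur,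
    isSiegelDelta_mul L e dV hdV dW hdW (isSiegelDelta_inv L e dV hdV dW hdW hm₁P) (isSiegelDelta_of_mem_unipDelta L e dV hdV dW hdW huN),
    mul_mem hp₂r (inv_mem hm₂r), isSiegelDelta_mul L e dV hdV dW hdW hp₂P (isSiegelDelta_inv L e dV hdV dW hdW hm₂P), ?_⟩
  calc γ = m₁⁻¹ * (m₁ * γ * m₂) * m₂⁻¹ := by simp only [mul_assoc, mul_inv_cancel, mul_one, inv_mul_cancel_left]
    _ = _ := by simp only [hγ', mul_assoc]

/-- **two rational pairs with the same matrix are equal** (`rationalPair` is a subgroup of `GL_{NM}(L)`). [folklore] -/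
theorem rationalPair_eq_of_coe_eq {g g' : UnitaryGroup.rationalPair (Fp L) L (IsCMField.complexConj L) N M (Matrix.diagonal dV) (Matrix.diagonal dW)}
    (h : ((g : GL (Fin N × Fin M) L) : Matrix (Fin N × Fin M) (Fin N × Fin M) L) = ((g' : GL (Fin N × Fin M) L) : Matrix (Fin N × Fin M) (Fin N × Fin M) L)) :
    g = g' :=
  Subtype.ext (Units.ext h)

/-- **a rational pair whose matrix is a sign diagonal `diag(1 − 2χ∘e)` is an involution** (`(1 − 2χ)² = 1` entrywise for a `0∕1` pattern). [folklore] -/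
theorem mul_self_of_coe_eq_signDiagonal {g : UnitaryGroup.rationalPair (Fp L) L (IsCMField.complexConj L) N M (Matrix.diagonal dV) (Matrix.diagonal dW)}
    {χ : Fin n → L} (hχ : ∀ k, χ k = 0 ∨ χ k = 1)
    (hg : ((g : GL (Fin N × Fin M) L) : Matrix (Fin N × Fin M) (Fin N × Fin M) L) = Matrix.diagonal (fun k => 1 - 2 * χ (e k))) : g * g = 1 := by
  obtain ⟨g', hg', hg'g'⟩ := exists_signInvolution L dV dW (χ := fun k => χ (e k)) fun k => hχ (e k)
  have hgg' : g = g' := rationalPair_eq_of_coe_eq L dV dW (hg.trans hg'.symm)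
  rw [hgg']; exact hg'g'

end Doubled

/-! ## §3 `n = 2`: the single middle representative `w₀` -/

section Two

variable (L : Type) [Field L] [NumberField L] [IsCMField L]
variable {N M : ℕ} (e : Fin N × Fin M ≃ Fin 2)
  (dV : Fin N → L) (hdV : ∀ i, IsCMField.complexConj L (dV i) = dV i)
  (dW : Fin M → L) (hdW : ∀ i, IsCMField.complexConj L (dW i) = dW i)

/-- **the standard middle reflection exists**: a rational pair `g₀` with matrix `diag(1 − 2·![0,1] ∘ e)` (`= diag(1, −1)` in the `e`-numbering),
`g₀² = 1` — ★ `exists_signInvolution` at the pattern `![0, 1]`. [cite: GelbartPiatetskishapiroRallis1987, Part A §1] -/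
theorem exists_reflStd :
    ∃ g₀ : UnitaryGroup.rationalPair (Fp L) L (IsCMField.complexConj L) N M (Matrix.diagonal dV) (Matrix.diagonal dW),
      ((g₀ : GL (Fin N × Fin M) L) : Matrix (Fin N × Fin M) (Fin N × Fin M) L) = Matrix.diagonal (fun k => 1 - 2 * (![0, 1] : Fin 2 → L) (e k)) ∧
        g₀ * g₀ = 1 :=
  exists_signInvolution L dV dW (χ := fun k => (![0, 1] : Fin 2 → L) (e k)) fun k => by
    generalize e k = i
    fin_cases i
    · exact Or.inl rfl
    · exact Or.inr rfl

omit [NumberField L] [IsCMField L] in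
/-- the pattern `![0, 1]` is a `0∕1` pattern. [folklore] -/
theorem pattern_std (k : Fin 2) : (![0, 1] : Fin 2 → L) k = 0 ∨ (![0, 1] : Fin 2 → L) k = 1 := by
  fin_cases k
  · exact Or.inl rfl
  · exact Or.inr rfl

/-- **`n = 2`: EVERY MIDDLE RATIONAL ELEMENT LIES IN THE ONE DOUBLE COSET `P_Δ(L⁺) · w₀ · P_Δ(L⁺)`.**  For `e : Fin N × Fin M ≃ Fin 2` and ANY rational pair
`g₀` with matrix `diag(1 − 2·![0,1] ∘ e)`: every `γ ∈ H(L⁺)` with `γ ∉ P_Δ` and `det C(γ)` not a unit is `γ = p · ι(1, g₀ ⊗ 1) · p'` with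
`p, p' ∈ P_Δ(L⁺)` rational and Siegel.  (Sorted face §2: the pattern is monotone with a `0` (off the big cell) and a `1` (off `P_Δ`, ★
`exists_apply_eq_one_of_not_isSiegelDelta`), hence `![0, 1]` (`pattern_fin_two_eq`); rational pairs with equal matrices coincide.)  This is the
rank-one cell of [GPSR87, Part A §1] for the doubled unitary group of a `2`-dimensional hermitian space.
[cite: GelbartPiatetskishapiroRallis1987, Part A §§1–2] [cite: KudlaRallis1994, §1] [cite: MoeglinWaldspurger1995, II.1.7] -/
theorem exists_siegel_mul_reflStd_mul_siegel (hdV0 : ∀ i, dV i ≠ 0) (hdW0 : ∀ i, dW i ≠ 0)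
    {g₀ : UnitaryGroup.rationalPair (Fp L) L (IsCMField.complexConj L) N M (Matrix.diagonal dV) (Matrix.diagonal dW)}
    (hg₀ : ((g₀ : GL (Fin N × Fin M) L) : Matrix (Fin N × Fin M) (Fin N × Fin M) L) = Matrix.diagonal (fun k => 1 - 2 * (![0, 1] : Fin 2 → L) (e k)))
    {γ : HA L e dV hdV dW hdW} (hγ : γ ∈ ratH L e dV hdV dW hdW) (h0 : ¬ IsSiegelDelta L e dV hdV dW hdW γ)
    (hn : ¬ IsUnit (Matrix.fromBlocks (1 : Matrix (Fin 2) (Fin 2) (AdeleRing (𝓞 L) L)) 0 (-1) 1 * blk L e dV hdV dW hdW γ * Matrix.fromBlocks 1 0 1 1).toBlocks₂₁.det) :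
    ∃ p p' : HA L e dV hdV dW hdW, p ∈ ratH L e dV hdV dW hdW ∧ IsSiegelDelta L e dV hdV dW hdW p ∧ p' ∈ ratH L e dV hdV dW hdW ∧
      IsSiegelDelta L e dV hdV dW hdW p' ∧
      γ = p * iotaGG L e dV hdV dW hdW
        (1, UnitaryGroup.rationalPairToAdelic (Fp L) L (IsCMField.complexConj L) N M (Matrix.diagonal dV) (Matrix.diagonal dW) g₀) * p' := by
  obtain ⟨g, χ, p, p', hχ, hmono, hk, hg, -, hpr, hpP, hp'r, hp'P, hγe⟩ :=
    exists_siegel_mul_refl_mul_siegel_sorted L e dV hdV dW hdW hdV0 hdW0 hγ hn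
  have h1 : ∃ k, χ k = 1 := exists_apply_eq_one_of_not_isSiegelDelta L e dV hdV dW hdW hχ hg hpP hp'P hγe h0
  have hχe : χ = ![0, 1] := pattern_fin_two_eq hχ hmono hk h1
  subst hχe
  have hgg₀ : g = g₀ := rationalPair_eq_of_coe_eq L dV dW (hg.trans hg₀.symm)
  subst hgg₀
  exact ⟨p, p', hpr, hpP, hp'r, hp'P, hγe⟩

/-- **`n = 2`, coset form**: with `g₀`, `w₀ = ι(1, g₀ ⊗ 1)` as above, every `γ ∈ H(L⁺)` off `P_Δ` and off the big cell has `P_Δ(L⁺) γ = P_Δ(L⁺) · w₀ p'`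
for some rational Siegel `p'`, i.e. `IsSiegelDelta (γ · (w₀ p')⁻¹)` — the reading ★ `mk_eq_mk_iff_isSiegelDelta` consumes.
[cite: GelbartPiatetskishapiroRallis1987, Part A §1] -/
theorem exists_siegel_reflStd_coset (hdV0 : ∀ i, dV i ≠ 0) (hdW0 : ∀ i, dW i ≠ 0)
    {g₀ : UnitaryGroup.rationalPair (Fp L) L (IsCMField.complexConj L) N M (Matrix.diagonal dV) (Matrix.diagonal dW)}
    (hg₀ : ((g₀ : GL (Fin N × Fin M) L) : Matrix (Fin N × Fin M) (Fin N × Fin M) L) = Matrix.diagonal (fun k => 1 - 2 * (![0, 1] : Fin 2 → L) (e k)))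
    {γ : HA L e dV hdV dW hdW} (hγ : γ ∈ ratH L e dV hdV dW hdW) (h0 : ¬ IsSiegelDelta L e dV hdV dW hdW γ)
    (hn : ¬ IsUnit (Matrix.fromBlocks (1 : Matrix (Fin 2) (Fin 2) (AdeleRing (𝓞 L) L)) 0 (-1) 1 * blk L e dV hdV dW hdW γ * Matrix.fromBlocks 1 0 1 1).toBlocks₂₁.det) :
    ∃ p' : HA L e dV hdV dW hdW, p' ∈ ratH L e dV hdV dW hdW ∧ IsSiegelDelta L e dV hdV dW hdW p' ∧
      IsSiegelDelta L e dV hdV dW hdW (γ * (iotaGG L e dV hdV dW hdW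
        (1, UnitaryGroup.rationalPairToAdelic (Fp L) L (IsCMField.complexConj L) N M (Matrix.diagonal dV) (Matrix.diagonal dW) g₀) * p')⁻¹) := by
  obtain ⟨p, p', hpr, hpP, hp'r, hp'P, hγe⟩ := exists_siegel_mul_reflStd_mul_siegel L e dV hdV dW hdW hdV0 hdW0 hg₀ hγ h0 hn
  refine ⟨p', hp'r, hp'P, ?_⟩
  rw [hγe]
  simp only [mul_inv_rev, mul_assoc, mul_inv_cancel_left, mul_inv_cancel, mul_one]
  exact hpP

end Two

end Summit.HodgeConjecture.HodgeConjecture.Cruxes.HLiu418.K2LiuSiegelMiddleCellSortedPattern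

end
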